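import Summits.BirchSwinnertonDyer.BirchSwinnertonDyer.Theorems.QuadraticBranchSignedControlPlusEtaNonsurjMultiplicativeFrobeniusTrace
import Summits.BirchSwinnertonDyer.BirchSwinnertonDyer.Theorems.QuadraticBranchSignedControlPlusEtaNonsurjPartnerSplitting
import Summits.BirchSwinnertonDyer.BirchSwinnertonDyer.Theorems.QuadraticBranchSignedControlPlusEtaNonsurjPartnerIdle
import HarnessLib

/-!
# Route `QuadraticBranchSignedControl` (rung K8, cell `bsd-potss`): crux stmt-BirchSwinnertonDyer-19606
# `PlusEtaMainConjectureNonsurj` — THE ADDITIVE PARTNER AT THE MULTIPLICATIVE PRIMES: `a_ℓ(W) = (ℓ/p)·a_ℓ(V)`, `ρ̄_{W,p}` unramified at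
# `ℓ`, and the level-raising shape `tr ρ̄_{W,p}(Frob_ℓ) = a_ℓ(W)·(ℓ+1)` for the partner `W` of a row `V = C • W^{(p*)}`

WHAT. Companion of `…PlusEtaNonsurjPartnerSplitting` (splitting law of the partner) and `…MultiplicativeFrobeniusTrace` (trace form for the
row). The partner `W` (globally minimal, `C • W^{(p*)} = V`) is NOT a row (it is additive at `p`), but its mod-`p` image lies in `C_ns⁺(ε)`
(`hasNonsplitCartanModPImage_partner_of_row`, g9) and it is multiplicative at the same primes `ℓ ≠ p` (`Additive.mult_iff_of_twist_pStar`);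
the Tate eigenvector of parts 1/3a (W-level lemmas) and `det = χ_p = ℓ` then give the partner's own versions:

* `lFunction_partner_eq_legendreSym_mul_of_row` — **`a_ℓ(W) = (ℓ/p)·a_ℓ(V)`** (`W.LFunction ℓ = legendreSym p ℓ * V.LFunction ℓ`), the
  splitting law of p601465 in Hasse–Weil-coefficient form;
* `smul_eq_self_of_mem_inertia_partner_of_row` — `I_𝔓` acts trivially on `W[p]` at every multiplicative `ℓ ≠ p` (`ρ̄_{W,p}` unramified at
  `ℓ`; Tate inertia unipotent + g9's `smul_eq_self_of_transvection_partner`);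
* **`trace_resGalOfEmb_partner_eq_lFunction_mul_of_row`** / **`trace_frob_partner_eq_lFunction_mul_of_row`** — `tr ρ̄_{W,p}(σ) =
  a_ℓ(W)·(ℓ+1)` in `𝔽_p` for the restricted local Frobenius and for EVERY arithmetic Frobenius `σ` at every `𝔓 ∣ ℓ` (the dichotomy of
  part 1 needs only `Im ρ̄ ⊆ C_ns⁺(ε)`: Cartan ⟹ scalar, `ℓ ≡ 1`; coset ⟹ trace `0`, `ℓ ≡ −1`).

HONEST FRAMING (cell `bsd-potss`, run/shared/lean/pub/bsd-potss/; FULL-BSD rank ≤ 1 programme): TOOL THEOREMS ONLY (no definition, no named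
fact, no `sorry`, axioms standard). Nothing is booked; crux 19606 stays OPEN; `BSD(W, p)` is claimed for no pair. Seat `bsd-potss-k8eta-c2` g12
(prover), `--supports stmt-BirchSwinnertonDyer-19606`.

References: [Serre1972] §1.11–§1.12, §2.2; [SilvermanAEC2009] VII.5 Prop. 5.1 (b), X.5 Cor. 5.4, Exercise 8.19 (a), §C.16;
[SilvermanATAEC1994] V.4–V.5, Ex. 5.13 (b); [IrelandRosen1990] Ch. 5 §2 Thm. 1.
-/

set_option autoImplicit false
set_option linter.dupNamespace false

noncomputable section

open scoped Classical NNReal Pointwise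

open Matrix Field IsDedekindDomain NumberField WeierstrassCurve Literature.NumberTheory.EllipticCurves
  Literature.NumberTheory.GaloisRepresentations Literature.NumberTheory.SerreUniformity
  Rat.HeightOneSpectrum IsDedekindDomain.HeightOneSpectrum Summit.BirchSwinnertonDyer.Rank1Residual
  Summit.BirchSwinnertonDyer.Rank1Residual.Additive

namespace Summit.BirchSwinnertonDyer.BirchSwinnertonDyer.Theorems.EtaCartanField

section Partner

variable (V : WeierstrassCurve ℚ) [V.IsElliptic] [V.IsGloballyMinimal] (W : WeierstrassCurve ℚ) [W.IsElliptic] [W.IsGloballyMinimal]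
  (C : VariableChange ℚ) (p : ℕ) [hp : Fact p.Prime]

omit [V.IsGloballyMinimal] [W.IsGloballyMinimal] in
/-- **The partner is multiplicative at the same primes `ℓ ≠ p`** (`Additive.mult_iff_of_twist_pStar`, restated for the crux's parameter
`p* = (−1)^{⌊p/2⌋} p`). [cite: SilvermanAEC2009, VII.5 Prop. 5.1(b)] -/
theorem hasMultiplicativeReductionAtPrime_partner_iff (hp2 : p ≠ 2) (hVW : C • W.quadraticTwist ((-1) ^ (p / 2) * p) = V) (ℓ : ℕ)
    [Fact ℓ.Prime] (hℓp : ℓ ≠ p) : W.HasMultiplicativeReductionAtPrime ℓ ↔ V.HasMultiplicativeReductionAtPrime ℓ := by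
  obtain ⟨d, k, hdk, hdp, hdq⟩ := exists_pStar_eq p hp2
  have hVW' : C • W.quadraticTwist (d : ℚ) = V := by rw [hdq]; exact hVW
  exact (mult_iff_of_twist_pStar p W hdk hdp C hVW' hℓp).symm

/-- **`a_ℓ(W) = (ℓ/p)·a_ℓ(V)` at every multiplicative prime `ℓ ≠ p` of a row** (`W.LFunction ℓ = legendreSym p ℓ * V.LFunction ℓ`): the
splitting law `hasSplitMultiplicativeReductionAtPrime_iff_legendreSym_iff_of_twist_pStar` in Hasse–Weil-coefficient form (`a_ℓ = +1` split,
`−1` non-split). [cite: SilvermanAEC2009, VII.5 Prop. 5.1(b), X.5 Cor. 5.4 and Exercise 8.19(a)] [cite: IrelandRosen1990, Ch. 5 §2 Thm. 1] -/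
theorem lFunction_partner_eq_legendreSym_mul_of_row (hp5 : 5 ≤ p) (hVW : C • W.quadraticTwist ((-1) ^ (p / 2) * p) = V)
    (hgood : V.HasGoodReductionAtPrime p) (hap : V.frobeniusTrace p = 0) (hns : ¬ ∀ m : ℕ, V.HasSurjectiveModNGaloisRep (p ^ m : ℕ))
    (ℓ : ℕ) [hℓ : Fact ℓ.Prime] (hℓp : ℓ ≠ p) (hmult : V.HasMultiplicativeReductionAtPrime ℓ) :
    W.LFunction ℓ = legendreSym p ℓ * V.LFunction ℓ := by
  have hp2 : p ≠ 2 := by omega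
  haveI : NeZero p := ⟨hp.out.ne_zero⟩
  have hℓ2 : ℓ ≠ 2 := by
    have := le_add_one_of_hasMultiplicativeReduction_of_row V p hp5 hgood hap hns ℓ hℓp hmult
    omega
  have hmultW : W.HasMultiplicativeReductionAtPrime ℓ := (hasMultiplicativeReductionAtPrime_partner_iff V W C p hp2 hVW ℓ hℓp).mpr hmult
  have hlaw := hasSplitMultiplicativeReductionAtPrime_iff_legendreSym_iff_of_twist_pStar V W C p hp2 hVW ℓ hℓ2 hℓp hmultW
  -- `(ℓ/p) = ±1`
  have hleg : legendreSym p ℓ = 1 ∨ legendreSym p ℓ = -1 := by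
    have hℓ0 : ((ℓ : ℤ) : ZMod p) ≠ 0 := by
      rw [Int.cast_natCast, Ne, ZMod.natCast_eq_zero_iff]
      exact fun h => hℓp ((Nat.prime_dvd_prime_iff_eq hp.out hℓ.out).mp h).symm
    by_cases h1 : legendreSym p ℓ = 1
    · exact Or.inl h1
    · exact Or.inr ((legendreSym.eq_neg_one_iff_not_one p hℓ0).mpr h1)
  by_cases hsV : V.HasSplitMultiplicativeReductionAtPrime ℓ
  · rw [V.LFunction_apply_prime_of_hasSplitMultiplicativeReductionAtPrime ℓ hsV, mul_one]
    rcases hleg with h | h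
    · rw [h]; exact W.LFunction_apply_prime_of_hasSplitMultiplicativeReductionAtPrime ℓ ((hlaw.mp hsV).mp h)
    · rw [h]
      refine W.LFunction_apply_prime_of_hasMultiplicativeReductionAtPrime_of_not_split ℓ hmultW fun hsW => ?_
      have := (hlaw.mp hsV).mpr hsW
      rw [h] at this
      norm_num at this
  · rw [V.LFunction_apply_prime_of_hasMultiplicativeReductionAtPrime_of_not_split ℓ hmult hsV, mul_neg, mul_one]
    rcases hleg with h | h
    · rw [h]
      refine W.LFunction_apply_prime_of_hasMultiplicativeReductionAtPrime_of_not_split ℓ hmultW fun hsW => hsV (hlaw.mpr ?_)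
      exact ⟨fun _ => hsW, fun _ => h⟩
    · rw [h, neg_neg]
      refine W.LFunction_apply_prime_of_hasSplitMultiplicativeReductionAtPrime ℓ ?_
      by_contra hsW
      exact hsV (hlaw.mpr ⟨fun h1 => absurd (h.symm.trans h1) (by norm_num), fun hs => absurd hs hsW⟩)

omit [W.IsGloballyMinimal] in
/-- **`ρ̄_{W,p}` is unramified at every multiplicative `ℓ ≠ p`**: for the partner `W` of a row, every prime `𝔓 ∣ ℓ` of `ℤ̄` and every `j ∈ I_𝔓`,
`j` acts trivially on `W[p]` (Tate inertia is unipotent at the multiplicative place of `W`; no transvection on `W[p]`,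
`smul_eq_self_of_transvection_partner`). [cite: SilvermanATAEC1994, V.4–V.5 and Exercise 5.13 (b)] [cite: Serre1972, §2.2] -/
theorem smul_eq_self_of_mem_inertia_partner_of_row (hp5 : 5 ≤ p) (hVW : C • W.quadraticTwist ((-1) ^ (p / 2) * p) = V)
    (hgood : V.HasGoodReductionAtPrime p) (hap : V.frobeniusTrace p = 0) (hns : ¬ ∀ m : ℕ, V.HasSurjectiveModNGaloisRep (p ^ m : ℕ))
    (ℓ : ℕ) [hℓ : Fact ℓ.Prime] (hℓp : ℓ ≠ p) (hmult : V.HasMultiplicativeReductionAtPrime ℓ) {v : HeightOneSpectrum (𝓞 ℚ)}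
    (hv : (primesEquiv v : ℕ) = ℓ) {𝔓 : Ideal (absIntegers (𝓞 ℚ) ℚ)} (h𝔓 : 𝔓 ∈ v.primesAbove) {j : absoluteGaloisGroup ℚ}
    (hj : j ∈ 𝔓.inertia (absoluteGaloisGroup ℚ)) (P : W.geomTorsion p) : j • P = P := by
  have hpp : p.Prime := hp.out
  have hp2 : p ≠ 2 := by omega
  have hmultW : W.HasMultiplicativeReductionAtPrime ℓ := (hasMultiplicativeReductionAtPrime_partner_iff V W C p hp2 hVW ℓ hℓp).mpr hmult
  have hmultAt : W.HasMultiplicativeReductionAt v := hasMultiplicativeReductionAt_of_primesEquiv_eq W hmultW hv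
  have hpv : (p : 𝓞 ℚ) ∉ v.asIdeal := natCast_not_mem_asIdeal_of_primesEquiv_ne hpp (hv ▸ hℓp)
  obtain ⟨w, hw⟩ := v.exists_spectralValuation
  obtain ⟨𝔐, h𝔐⟩ := v.localPrimesAbove_nonempty
  set ι := closureEmb (K := ℚ) (v.adicCompletion ℚ) with hι
  have h𝔓₁ : v.primeBelow ι 𝔐 ∈ v.primesAbove := primeBelow_mem_primesAbove h𝔐
  obtain ⟨g, hg⟩ := exists_smul_eq_of_mem_primesAbove_holds (K := ℚ) (v := v) h𝔓₁ h𝔓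
  have hj₁ : g⁻¹ * j * g ∈ (v.primeBelow ι 𝔐).inertia (absoluteGaloisGroup ℚ) := by
    rw [← hg] at hj
    exact X2.CongruentPartnerTrace.conj_mem_inertia_of_mem hj
  obtain ⟨σ, hσI, hσj⟩ := IsDedekindDomain.HeightOneSpectrum.exists_mem_inertia_apply_eq_holds v ι h𝔐 hj₁
  have hjres : resGalOfEmb ι σ = g⁻¹ * j * g := resGalOfEmb_eq_of_apply_eq ι hσj
  have hinj : Function.Injective (pointsMapOfEmb W ι) := pointsMapOfEmb_injective W ι
  have hunip : ∀ Q : W.geomTorsion p, (g⁻¹ * j * g) • ((g⁻¹ * j * g) • Q) + Q =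
      (g⁻¹ * j * g) • Q + (g⁻¹ * j * g) • Q := by
    intro Q
    have hQ' : p ^ 1 • pointsMapOfEmb W ι (Q : geomPoints W) = 0 := by
      rw [pow_one, ← map_nsmul, ← natCast_zsmul]
      have h2 : ((p : ℕ) : ℤ) • (Q : geomPoints W) = 0 := (Submodule.mem_torsionBy_iff _ _).mp Q.2
      rw [h2, map_zero]
    have key := W.smul_smul_sub_eq_of_mem_inertia_of_hasMultiplicativeReductionAt hmultAt hpp hpv (le_refl 1)
      hw h𝔐 hσI (pointsMapOfEmb W ι (Q : geomPoints W)) hQ'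
    have key' : (g⁻¹ * j * g) • ((g⁻¹ * j * g) • (Q : geomPoints W) - Q) = (g⁻¹ * j * g) • (Q : geomPoints W) - Q := by
      apply hinj
      rw [← hjres]
      simp only [map_sub, pointsMapOfEmb_smul]
      exact key
    apply Subtype.ext
    simp only [AddSubgroup.coe_add, Literature.NumberTheory.EllipticCurves.AddSubgroup.torsionBy.coe_smul]
    rw [smul_sub] at key'
    exact sub_eq_sub_iff_add_eq_add.mp key'
  have htriv := smul_eq_self_of_transvection_partner V W C p hp5 hVW hgood hap hns hunip
  have hjeq : j = g * (g⁻¹ * j * g) * g⁻¹ := by group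
  rw [hjeq, mul_smul, mul_smul, htriv (g⁻¹ • P), smul_inv_smul]

/-- **Trace form for the partner, restricted local Frobenius: `tr ρ̄_{W,p}(τ|_{ℚ̄}) = a_ℓ(W)·(ℓ+1)` in `𝔽_p`.** The image of `ρ̄_{W,p}` lies in
`C_ns⁺(ε)` (`hasNonsplitCartanModPImage_partner_of_row`); `W[p]` has the rational eigenvector of eigenvalue `a_ℓ(W)·ℓ` (parts 1/3a applied to
`W`) and `det = χ_p = ℓ`; in the Cartan the matrix is scalar with `ℓ ≡ 1`, in the coset its trace is `0` with `ℓ ≡ −1` (part 1).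
[cite: Serre1972, §2.2, §1.11–§1.12] [cite: SilvermanAEC2009, Exercise 8.19(a) and §C.16] -/
theorem trace_resGalOfEmb_partner_eq_lFunction_mul_of_row (hp5 : 5 ≤ p) (hVW : C • W.quadraticTwist ((-1) ^ (p / 2) * p) = V)
    (hgood : V.HasGoodReductionAtPrime p) (hap : V.frobeniusTrace p = 0) (hns : ¬ ∀ m : ℕ, V.HasSurjectiveModNGaloisRep (p ^ m : ℕ))
    (ℓ : ℕ) [hℓ : Fact ℓ.Prime] (hℓp : ℓ ≠ p) (hmult : V.HasMultiplicativeReductionAtPrime ℓ) {v : HeightOneSpectrum (𝓞 ℚ)}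
    (hv : (primesEquiv v : ℕ) = ℓ) {𝔐 : Ideal v.localAbsIntegers} (h𝔐 : 𝔐 ∈ v.localPrimesAbove)
    {τ : absoluteGaloisGroup (v.adicCompletion ℚ)} (hτ : IsArithFrobAt (v.adicCompletionIntegers ℚ) τ 𝔐) :
    letI : Module (ZMod p) (W.geomTorsion p) := AddSubgroup.torsionBy.zmodModule
    LinearMap.trace (ZMod p) (W.geomTorsion p)
        ((galoisRepTorsion W p (resGalOfEmb (closureEmb (K := ℚ) (v.adicCompletion ℚ)) τ)).toAdd.toAddMonoidHom.toZModLinearMap p)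
      = ((W.LFunction ℓ : ℤ) : ZMod p) * ((ℓ : ZMod p) + 1) := by
  letI : Module (ZMod p) (W.geomTorsion p) := AddSubgroup.torsionBy.zmodModule
  have hpp : p.Prime := hp.out
  have hp2 : p ≠ 2 := by omega
  haveI : NeZero p := ⟨hpp.ne_zero⟩
  have hℓ2 : ℓ ≠ 2 := by
    have := le_add_one_of_hasMultiplicativeReduction_of_row V p hp5 hgood hap hns ℓ hℓp hmult
    omega
  have hmultW : W.HasMultiplicativeReductionAtPrime ℓ := (hasMultiplicativeReductionAtPrime_partner_iff V W C p hp2 hVW ℓ hℓp).mpr hmult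
  set σ₁ := resGalOfEmb (closureEmb (K := ℚ) (v.adicCompletion ℚ)) τ with hσ₁
  obtain ⟨e, ε, hε, himg⟩ := hasNonsplitCartanModPImage_partner_of_row V W C p hp5 hVW hgood hap hns
  obtain ⟨M, hM, hσM⟩ := himg σ₁
  rw [trace_eq_matrix_trace e hσM]
  -- eigenvector of eigenvalue `a ℓ`, `a = a_ℓ(W) = ±1`
  obtain ⟨a, haL, ha1, Q, hQ0, hσQ⟩ : ∃ a : ℤ, W.LFunction ℓ = a ∧ (a = 1 ∨ a = -1) ∧ ∃ Q : W.geomTorsion p, Q ≠ 0 ∧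
      σ₁ • Q = (a * (ℓ : ℤ)) • Q := by
    by_cases hsplit : W.HasSplitMultiplicativeReductionAtPrime ℓ
    · have hsplitAt : W.HasSplitMultiplicativeReductionAt v := by
        have key : ∀ (q : ℕ) (hq : Fact q.Prime), q = ℓ → @WeierstrassCurve.HasSplitMultiplicativeReductionAtPrime W q hq := by
          rintro q hq rfl; exact hsplit
        exact (hasSplitMultiplicativeReductionAtPrime_iff_hasSplitMultiplicativeReductionAt W v).mp (key _ _ hv)
      obtain ⟨Q, hQ0, hQ⟩ := exists_eigenvector_resGalOfEmb_of_hasSplitMultiplicativeReductionAt W hsplitAt hpp hv hℓp h𝔐 hτ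
      exact ⟨1, W.LFunction_apply_prime_of_hasSplitMultiplicativeReductionAtPrime ℓ hsplit, Or.inl rfl, Q, hQ0, by rwa [one_mul]⟩
    · obtain ⟨Q, hQ0, hQ⟩ := exists_eigenvector_resGalOfEmb_of_not_hasSplitMultiplicativeReductionAtPrime W hpp hℓ2 hℓp
        hmultW hsplit hv h𝔐 hτ
      exact ⟨-1, W.LFunction_apply_prime_of_hasMultiplicativeReductionAtPrime_of_not_split ℓ hmultW hsplit, Or.inr rfl, Q, hQ0,
        by rwa [neg_one_mul]⟩
  rw [haL]
  have hx0 : e Q ≠ 0 := fun h0 => hQ0 (e.injective (by rw [h0, map_zero]))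
  have hMx : M *ᵥ e Q = ((a : ZMod p) * (ℓ : ZMod p)) • e Q := by
    rw [← hσM Q, hσQ, map_zsmul, ← Int.cast_smul_eq_zsmul (ZMod p), Int.cast_mul, Int.cast_natCast]
  have hs2 : (a : ZMod p) ^ 2 = 1 := by
    rcases ha1 with rfl | rfl
    · rw [Int.cast_one, one_pow]
    · rw [Int.cast_neg, Int.cast_one, neg_one_sq]
  have hdet : M.det = (ℓ : ZMod p) := by
    rw [det_eq_modNCyclotomicCharacter W p hpp.two_le e σ₁ M hσM, hσ₁,
      modNCyclotomicCharacter_resGalOfEmb_eq_of_isArithFrobAt hv hℓp h𝔐 hτ]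
  have hℓ0 : (ℓ : ZMod p) ≠ 0 := by
    rw [Ne, ZMod.natCast_eq_zero_iff]
    exact fun h => hℓp ((Nat.prime_dvd_prime_iff_eq hpp hℓ.out).mp h).symm
  by_cases hMC : M ∈ nonsplitCartan ε
  · have hℓ1 := eq_one_of_mem_nonsplitCartan_of_mulVec_eq hε hMC hx0 hs2 hMx hdet hℓ0
    rw [eq_smul_one_of_mem_nonsplitCartan_of_mulVec_eq hε hMC hx0 hMx, Matrix.trace_smul, Matrix.trace_one, Fintype.card_fin,
      hℓ1, smul_eq_mul]
    ring
  · have hℓ1 := eq_neg_one_of_not_mem_nonsplitCartan_of_mulVec_eq hM hMC hx0 hs2 hMx hdet hℓ0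
    obtain ⟨c, d, -, rfl⟩ := exists_eq_coset_of_not_mem_nonsplitCartan hM hMC
    rw [Matrix.trace_fin_two_of, hℓ1]
    ring

/-- **Trace form for the partner, every Frobenius: `tr ρ̄_{W,p}(σ) = a_ℓ(W)·(ℓ+1)`** for every arithmetic Frobenius `σ` at every prime
`𝔓 ∣ ℓ` of `ℤ̄` (`σ = j · g τ|_{ℚ̄} g⁻¹` on `W[p]` with `j ∈ I_𝔓` trivial; the trace is a class function). With `a_ℓ(W) = (ℓ/p) a_ℓ(V)`.
[cite: Serre1972, §2.2, §1.11–§1.12] [cite: SilvermanAEC2009, Exercise 8.19(a) and §C.16] -/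
theorem trace_frob_partner_eq_lFunction_mul_of_row (hp5 : 5 ≤ p) (hVW : C • W.quadraticTwist ((-1) ^ (p / 2) * p) = V)
    (hgood : V.HasGoodReductionAtPrime p) (hap : V.frobeniusTrace p = 0) (hns : ¬ ∀ m : ℕ, V.HasSurjectiveModNGaloisRep (p ^ m : ℕ))
    (ℓ : ℕ) [hℓ : Fact ℓ.Prime] (hℓp : ℓ ≠ p) (hmult : V.HasMultiplicativeReductionAtPrime ℓ) {v : HeightOneSpectrum (𝓞 ℚ)}
    (hv : (primesEquiv v : ℕ) = ℓ) {𝔓 : Ideal (absIntegers (𝓞 ℚ) ℚ)} (h𝔓 : 𝔓 ∈ v.primesAbove) {σ : absoluteGaloisGroup ℚ}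
    (hσ : IsArithFrobAt (𝓞 ℚ) σ 𝔓) :
    letI : Module (ZMod p) (W.geomTorsion p) := AddSubgroup.torsionBy.zmodModule
    LinearMap.trace (ZMod p) (W.geomTorsion p) ((galoisRepTorsion W p σ).toAdd.toAddMonoidHom.toZModLinearMap p) =
      ((W.LFunction ℓ : ℤ) : ZMod p) * ((ℓ : ZMod p) + 1) := by
  letI : Module (ZMod p) (W.geomTorsion p) := AddSubgroup.torsionBy.zmodModule
  -- `σ = j · g σ₁ g⁻¹` with `j ∈ I_𝔓` trivial on `W[p]`
  obtain ⟨𝔐, h𝔐⟩ := v.localPrimesAbove_nonempty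
  obtain ⟨τ, hτ⟩ := exists_isArithFrobAt_localAbsIntegers v h𝔐
  set ι := closureEmb (K := ℚ) (v.adicCompletion ℚ) with hι
  set σ₁ : absoluteGaloisGroup ℚ := resGalOfEmb ι τ with hσ₁
  have h𝔓₁ : v.primeBelow ι 𝔐 ∈ v.primesAbove := primeBelow_mem_primesAbove h𝔐
  have hσ₁frob : IsArithFrobAt (𝓞 ℚ) σ₁ (v.primeBelow ι 𝔐) := WeierstrassCurve.isArithFrobAt_resGalOfEmb h𝔐 ι hτ
  obtain ⟨g, hg⟩ := exists_smul_eq_of_mem_primesAbove_holds (K := ℚ) (v := v) h𝔓₁ h𝔓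
  have hσ' : IsArithFrobAt (𝓞 ℚ) (g * σ₁ * g⁻¹) 𝔓 := by rw [← hg]; exact hσ₁frob.conj g
  have hjI : σ * (g * σ₁ * g⁻¹)⁻¹ ∈ 𝔓.inertia (absoluteGaloisGroup ℚ) := hσ.mul_inv_mem_inertia hσ'
  have hστ : ∀ P : W.geomTorsion p, σ • P = g • (σ₁ • (g⁻¹ • P)) := fun P => by
    have hσeq : σ = (σ * (g * σ₁ * g⁻¹)⁻¹) * (g * σ₁ * g⁻¹) := by group
    conv_lhs => rw [hσeq]
    rw [mul_smul, smul_eq_self_of_mem_inertia_partner_of_row V W C p hp5 hVW hgood hap hns ℓ hℓp hmult hv h𝔓 hjI, mul_smul, mul_smul]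
  obtain ⟨e, ε, -, himg⟩ := hasNonsplitCartanModPImage_partner_of_row V W C p hp5 hVW hgood hap hns
  obtain ⟨G, -, hG⟩ := himg g
  obtain ⟨G', -, hG'⟩ := himg g⁻¹
  obtain ⟨M₁, -, hM₁⟩ := himg σ₁
  obtain ⟨hσM, hGG⟩ := matrix_conj_of_smul_eq_conj e hG hG' hM₁ hστ
  rw [trace_eq_matrix_trace e hσM, Matrix.trace_mul_cycle, hGG, Matrix.one_mul, ← trace_eq_matrix_trace e hM₁, hσ₁]
  exact trace_resGalOfEmb_partner_eq_lFunction_mul_of_row V W C p hp5 hVW hgood hap hns ℓ hℓp hmult hv h𝔐 hτ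

end Partner

end Summit.BirchSwinnertonDyer.BirchSwinnertonDyer.Theorems.EtaCartanField

end
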